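import Summits.BirchSwinnertonDyer.BirchSwinnertonDyer.Theses.PrintX10b
import Summits.BirchSwinnertonDyer.BirchSwinnertonDyer.Theorems.PrintX10bTwoSidedLinkAnyClassNumberX10bOfPrintFactsPinnedLink
import HarnessLib

/-!
# Skeleton «print_leaves» for the crux B₃^pin `TwoSidedLinkAnyClassNumberX10bPinned` (stmt-BirchSwinnertonDyer-26622, PrintX10b r304)

Line-writer skeleton (linewriter-bsd-display13-1 g0, 2026-08-31). COMPOSITION / PRINT LINE — NOT leaf progress, NOT research —
with the bundle `PinnedTransferPrintFacts` (26358) UNBUNDLED so that its one flagged conjunct is a stub of its own.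
BSD is not proved by this.

THE LINE. B₃^pin = «granted the TIED Howard containment for the frame's own parametrisation (p ∤ c(Dt)), the two-sided
IMC∘BDP identity `X11b.IMCWaldspurgerOnTreeGoodAt` at the induced place on every rank-one X10b Heegner datum (ClassX10 ⇒ p = 3,
¬Surj 3, ¬CM; odd d_K ≠ −3), ANY class number». The door `TwoSidedLinkAnyClassNumberX10bPinnedOfPrint` (26624) is CLOSED
(`PrintX10bPinned.twoSidedLinkAnyClassNumberX10bPinnedOfPrint_holds`): it unpacks the five-conjunct bundle
hPT = ⟨h57, h59gp, h422, h513, hC⟩ (`PinnedTransferPrintFacts`, 26358) and reads JSW Thm. 3.3.1 (h331) off `HeegnerPrintFactsX10b`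
(conjunct 8), then applies x10b-p3's landed
`Cruxes.TwoSidedLinkAnyClassNumberX10b.CompositeTransferX10b.twoSidedLinkAnyClassNumberX10bPinned_of_printFacts_of_pinnedTransfer`
(p608225; `ClassX10` supplies `p = 3`, `GoodOrd W 3`). This skeleton names the SIX printed inputs actually consumed as six stubs
(not the two bundles: the other 11 conjuncts of hHP are NOT used by B₃^pin) and proves `TwoSidedLinkAnyClassNumberX10bPinned_of`
in the kernel by that theorem, the stubs entering BY NAME. It is the p = 3 twin of the 26357 skeleton (same six stubs).

STUBS (print debt census of B₃^pin; five PURE CITE + one FLAGGED):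
* `stub_yanZhu57` — Yan–Zhu 2026 Thm. 5.7 (1): X_Gr Λ-torsion and char(X_Gr) = (L_p^BDP) (Greenberg Selmer side). PRINT, by name.
* `stub_yanZhu59Pinned` — **THE FLAGGED STUB** («YZ59-anyhK@BCK52-How04», conjunct 2 of 26358): Yan–Zhu Thm. 5.9 direction
  (2)⟹(1) for the PINNED family (`¬ p ∣ F.Dt.c`), CLASS-NUMBER-FREE: from the tied Howard containment to
  `L' ∈ char(X_ac)·` for a BDP p-adic L-function L'. Printed at p ∤ h_K; at p ∣ h_K print-by-omission (BCK21 Thm. 5.2 via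
  Castella 2017 App. A; REF leaf audit pending, acq-13689). Text VERBATIM = conjunct 2 of `PinnedTransferPrintFacts`.
* `stub_bcs422` — BCS 2025 Prop. 4.2.2: a BDP p-adic L-function with μ = 0 exists. PRINT, by name.
* `stub_cgls513` — CGLS 2022 Thm. 5.1.3: BDP value at the trivial character (disc formula). PRINT, by name.
* `stub_carayol` — Carayol 1986: level of the newform = conductor. PRINT, by name.
* `stub_jsw331` — Jetchev–Skinner–Wan 2017 Thm. 3.3.1: anticyclotomic control. PRINT, by name.
Honesty: every stub is a printed theorem entered as a named fact (typer / formalization work; (685)(c)); `_of` is x10b-p3's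
landed pinned-B₃ theorem (p = 3 and good ordinary from `ClassX10`, level `rfl`). The only conjunct
whose print status is not settled is isolated as `stub_yanZhu59Pinned`.
-/

set_option autoImplicit false
set_option linter.dupNamespace false

noncomputable section

namespace Summit.BirchSwinnertonDyer.BirchSwinnertonDyer.Cruxes.TwoSidedLinkAnyClassNumberX10bPinned.PrintLeaves

open scoped BigOperators Classical
open Summit.BirchSwinnertonDyer.BirchSwinnertonDyer.Theses.PrintX10b
open Literature

/-- Stub h57 (PRINT, by name): Yan–Zhu 2026 Thm. 5.7 (1). [cite: arXiv:2412.20078, Thm. 5.7 (1)] -/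
theorem stub_yanZhu57 : Literature.NumberTheory.EllipticCurves.YanZhu2026.thm57_isTorsion_charIdealXGr_eq_bdpLFunction := by
  sorry

/-- **Stub h59gp — THE FLAGGED STUB (YZ59-anyhK):** Yan–Zhu 2026 Thm. 5.9, direction (2)⟹(1), for the PINNED family
(`¬ p ∣ F.Dt.c`) and with NO class-number hypothesis — conjunct 2 of the route bundle `PinnedTransferPrintFacts` (26358),
text verbatim. Printed at p ∤ h_K; at p ∣ h_K by omission only (BCK21 Thm. 5.2 / Castella 2017 App. A; leaf audit pending).
[cite: arXiv:2412.20078, Thm. 5.9] [cite: arXiv:2008.02571, Thm. 5.2] -/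
theorem stub_yanZhu59Pinned : ∀ {p : ℕ} [Fact p.Prime] (ι' : PadicAlgCl p ≃+* ℂ) (W : WeierstrassCurve ℚ) [W.IsElliptic] [W.IsGloballyMinimal] (K : Type) [Field K] [NumberField K] (v vbar : IsDedekindDomain.HeightOneSpectrum (NumberField.RingOfIntegers K)) (κ : Literature.NumberTheory.EllipticCurves.ZpExtension K p) (γ : Field.absoluteGaloisGroup K) [Fact (κ.IsTopGenerator γ)] {N : ℕ} [NeZero N] {f : CuspForm (CongruenceSubgroup.Gamma0 N) 2} (jbar : AlgebraicClosure K →+* ℂ) (_ : Literature.NumberTheory.EllipticCurves.ModularForms.IsNewformOf W f), N = W.conductorNorm ℤ → 3 ≤ p → Literature.NumberTheory.EllipticCurves.Rank1Residual.GoodOrd W p → (W.baseChange K).HasIrreducibleModPGaloisRep p → Literature.NumberTheory.EllipticCurves.IsImaginaryQuadratic K → Literature.NumberTheory.EllipticCurves.SatisfiesHeegnerHypothesis N K → ((Ideal.span {(p : ℤ)}).primesOver (NumberField.RingOfIntegers K)).ncard = 2 → Odd (NumberField.discr K) → NumberField.discr K ≠ -3 → κ.IsAnticyclotomic → (∀ (w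 : NumberField.InfinitePlace K) (k : NumberField.RingOfIntegers K), k ∈ v.asIdeal ↔ ‖ι'.symm (w.embedding (k : K))‖ < 1) → ((p : ℕ) : NumberField.RingOfIntegers K) ∈ vbar.asIdeal → vbar ≠ v → ∃ (ΩK : ℂ) (Ωp : (Literature.NumberTheory.EllipticCurves.unrIntegers p)ˣ) (L' : Literature.NumberTheory.EllipticCurves.UnrSeries p), ΩK ≠ 0 ∧ Literature.NumberTheory.EllipticCurves.IsBDPLFunction ι' v κ γ f ΩK ((Ωp : Literature.NumberTheory.EllipticCurves.unrIntegers p) : ℂ_[p]) L' ∧ ∀ (D : (W.baseChange K).LambdaAdicSelmerData κ γ) (F : Literature.NumberTheory.EllipticCurves.HeegnerFamily N W K κ jbar) (X : (W.baseChange K).SelmerDualData κ γ) (j : ℤ_[p] →+* Literature.NumberTheory.EllipticCurves.unrIntegers p), ¬ (p : ℤ) ∣ F.Dt.c → (∀ x : ℤ_[p], ((j x : Literature.NumberTheory.EllipticCurves.unrIntegers p) : ℂ_[p]) = algebraMap ℚ_[p] ℂ_[p] (x : ℚ_[p])) → Literature.NumberTheory.EllipticCurves.heegnerCharIdeal D F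 ^ 2 ≤ Literature.NumberTheory.EllipticCurves.Module.charIdeal (Literature.NumberTheory.EllipticCurves.IwasawaAlgebra p) (Submodule.torsion (Literature.NumberTheory.EllipticCurves.IwasawaAlgebra p) X.X) → L' ∈ (Literature.NumberTheory.EllipticCurves.Castella2018.AcSelmer.XAc.charIdeal (W.baseChange K) p κ vbar ∅ γ).map (PowerSeries.map j) := by
  sorry

/-- Stub h422 (PRINT, by name): Burungale–Castella–Skinner 2025 Prop. 4.2.2 (BDP L-function with μ = 0). [cite: arXiv:2405.00270, Prop. 4.2.2] -/
theorem stub_bcs422 : Literature.NumberTheory.EllipticCurves.BurungaleCastellaSkinner2025.prop422_exists_isBDPLFunction_mu_eq_zero := by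
  sorry

/-- Stub h513 (PRINT, by name): Castella–Grossi–Lee–Skinner 2022 Thm. 5.1.3 (BDP value at the trivial character). [cite: CastellaGrossiLeeSkinner2022, Thm. 5.1.3] -/
theorem stub_cgls513 : Literature.NumberTheory.EllipticCurves.CastellaGrossiLeeSkinner2022.thm513_exists_isBDPLFunction_valueAtOne_disc := by
  sorry

/-- Stub hC (PRINT, by name): Carayol 1986 — the level of the newform attached to E is its conductor. [cite: Carayol1986] -/
theorem stub_carayol : ∀ (N : ℕ) [NeZero N], Literature.NumberTheory.EllipticCurves.ModularForms.IsNewformOf.level_eq_conductorNorm (N := N) := by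
  sorry

/-- Stub h331 (PRINT, by name): Jetchev–Skinner–Wan 2017 Thm. 3.3.1 (anticyclotomic control) — conjunct 8 of `HeegnerPrintFactsX10b`,
the only conjunct of that bundle B₃^pin consumes. [cite: JetchevSkinnerWan2017, Thm. 3.3.1] -/
theorem stub_jsw331 : Literature.NumberTheory.EllipticCurves.JetchevSkinnerWan2017.thm331_anticyclotomicControl := by
  sorry

/-- **Composition (kernel; the six print stubs used BY NAME): B₃^pin**, by x10b-p3's landed pinned-B₃ theorem (p608225) — the
body of the closed door `PrintX10bPinned.twoSidedLinkAnyClassNumberX10bPinnedOfPrint_holds` with the bundles opened. Stubs 1–5 are the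
conjuncts of the route bundle 26358 in order (scratch-verified on the X9 twin: `⟨stub₁,…,stub₅⟩ : PinnedTransferPrintFacts`, rc 0). -/
theorem TwoSidedLinkAnyClassNumberX10bPinned_of :
    Summit.BirchSwinnertonDyer.BirchSwinnertonDyer.Theses.PrintX10b.TwoSidedLinkAnyClassNumberX10bPinned :=
  Summit.BirchSwinnertonDyer.BirchSwinnertonDyer.Cruxes.TwoSidedLinkAnyClassNumberX10b.CompositeTransferX10b.twoSidedLinkAnyClassNumberX10bPinned_of_printFacts_of_pinnedTransfer
    stub_yanZhu57 (@stub_yanZhu59Pinned) stub_bcs422 stub_cgls513 (@stub_carayol) stub_jsw331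

end Summit.BirchSwinnertonDyer.BirchSwinnertonDyer.Cruxes.TwoSidedLinkAnyClassNumberX10bPinned.PrintLeaves

end
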